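import Literature.MathematicalPhysics.QuantumFieldTheory.Balaban1983to89.B9Thm314GFlatV1MultiLevelTorus
import Literature.MathematicalPhysics.QuantumFieldTheory.Balaban1983to89.B9Thm314GFlatV1DivTransfer
import Literature.MathematicalPhysics.QuantumFieldTheory.Balaban1983to89.B6Prop26DivKLevelPadV1

/-!
# `Balaban1983to89.B9Thm314GFlatV1All` — T. Bałaban, *Propagators for lattice gauge theories in a background field*, Commun. Math. Phys. **99**
# (1985) 389–434 [Balaban1985BackgroundPropagators], **THEOREM 3.14 (pp. 426–427, (3.154)) AT `U = 1` FOR THE GENUINE `k`-LEVEL `G = Δ_a⁻¹`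
# ((2.19)/(2.22) of [4] = [Balaban1984PropagatorsII]) ON THE V1 TORUS, FILE 5: (§1) THE (2.136)₃ MEMBER `G∇*` AND THE `L²` MEMBERS (2.140)₂,₃
# UNCONDITIONAL — `|((G[Ω] − G[Ω′])∇*_ν μ)(x)| ≤ C·(Lᵏ|c_f|⁻¹)·|μ|·E`, `‖ζ∇_ν(G[Ω] − G[Ω′])J‖₂, ‖ζ(G[Ω] − G[Ω′])∇*_νJ‖₂ ≤ C·(Lᵏ|c_f|⁻¹)·|ζ|·E·‖J‖₂`
# (`E = e^{−δ·min(d,d′)(y,y′)}·e^{−δ·d(y,y′,Ω)}`), by one instantiation each of FILE 4's members-modulo-majorants with the one-family (2.136)₃ theorem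
# `B6Prop26DivKLevelPadV1.prop26_2136_div_kLevel_unconditional_pad_V1`; AND (§2–§3) THE FOUR SUP MEMBERS (2.136)₁₋₄ AND THE THREE `L²` MEMBERS
# (2.140)₁₋₃ FOR THE DIFFERENCE OF TWO FAMILIES WITH ONE SET OF CONSTANTS** — the single printed sentence «their difference satisfies all the
# inequalities characteristic for operators of the considered type, with the additional factor exp(−δ₀d(y,y′,Ω))» for the operator `G` at `U = 1`
# (no existing module is touched; no definition, no fact is minted — theorems only)

statement-level skeleton of published theorems with citation tags; proofs where landed; nothing here is a claim about the Yang–Mills mass gap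

PDF held: `paper:balaban1985-cmp99-background-propagators` (journal page = PDF page + 388), pp. 426–427 [PDF 38–39] (text layer p0038
L37–L42, p0039 L4–L11: «Theorem 3.14. If we take a pair of operators constructed for the two sequences … their difference satisfies all
the inequalities characteristic for operators of the considered type, with the additional factor exp(−δ₀d(y,y′,Ω)) … (3.154)»);
`paper:balaban1984-cmp96-propagators-rt-ii` (journal page = PDF page + 222), p. 247 [PDF 25] (text layer p0025 L13–L18 and L31–L33: «Proposition 2.6.
… |(GJ)(x)|, |(∇GJ)(x)|, |(G∇*J)(x)|, |(ΔGJ)(x)| ≦ O(1)[(Lʲη)², Lʲη, Lʲη, 1]e^{−δ₃d(y,y′)}|J| (2.136)» and «‖ζGJ‖, ‖ζ∇GJ‖, ‖ζG∇*J‖, … ≦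
O(1)[(Lʲη)², Lʲη, Lʲη, 1, 1, 1]|ζ|e^{−δ₃d(y,y′)}‖J‖ (2.140)»).

CITATION HEADER (lean-in-tree rule) — WHAT IS REPRODUCED.  Phase-2 file of the `lit-balaban` typed skeleton (HOME `run/shared/lean/pub/lit-balaban/`),
unit `lit-balaban-p21` (proof seat p21, text of gen 21–23, free-target protocol G.5-34(d), TAKING 2026-08-23T21:56Z; filed gen 30, 2026-08-27, once the
one-family (2.136)₃ pad twin `B6Prop26DivKLevelPadV1` existed; B9 fold owner r06, referee ref-4);
SKELETON row B9.Thm3.14 (cells: Thm 3.14 at `U = 1` for the genuine `k`-level `G = Δ_a⁻¹`, members (2.136)₃, (2.140)₂,₃ unconditional; all members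
with one set of constants).  Sister files: `B9Thm314GFlatV1Kernel` (FILE 1), `B9Thm314GFlatV1Transfer` (FILE 2: (2.136)₁,₂), `B9Thm314GFlatV1MultiLevelTorus`
(FILE 3: (2.136)₄), `B9Thm314GFlatV1DivTransfer` (FILE 4: (2.136)₃ and (2.140)₂,₃ modulo the one-family (2.136)₃ majorants, (2.140)₁).

## WHAT THIS FILE CERTIFIES (kernel-checked)

* §1 **`thm314_Gdiv_flat_V1`** — THEOREM 3.14 AT `U = 1`, THE (2.136)₃ MEMBER FOR `G = Δ_a⁻¹`, UNCONDITIONAL: there are `δ, C, M₀ > 0`, `N₀ > 0` (on `d, L`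
  and the weight band `[b₀, b₁]` only) such that for every V1 torus, every pair of p21 torus families `D, D′` on it (`1 ≤ k`, `M_h = L^a ≥ 8`, `R ≥ 2L²`,
  `P_μ ≥ 5L`, `L ≥ 5`, `L·M_h ≥ M₀`, `R·L·M_h ≥ N₀ + 1`), every fine factor `c_f ≠ 0`, positive weights `w, w′` in the global band agreeing on the common
  index bonds, common top blocks `y, y′`, `supp μ ⊂ B′(y′)`, `|μ| ≤ B`, every direction `ν` and fine bond `x ∈ B(y)`:
  `|(G[Ω]∇*_ν μ)(x) − (G[Ω′]∇*_ν μ)(x)| ≤ C·(Lᵏ·|c_f|⁻¹)·B·e^{−δ·min(d(y,y′), d′(y,y′))}·e^{−δ·d(y,y′,Ω)}` (`G[Ω]∇*_ν = onFun (GE (domT hN D hk)) *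
  B6LapLegKLevelV1.DVa ν c_f`); §1 **`thm314_gradG_l2_flat_V1`**, **`thm314_Gdiv_l2_flat_V1`** — the `L²` members (2.140)₂,₃, UNCONDITIONAL:
  `Σ_x (ζ(x)(∇_ν(G[Ω] − G[Ω′])J)(x))², Σ_x (ζ(x)((G[Ω] − G[Ω′])∇*_νJ)(x))² ≤ (C·(Lᵏ|c_f|⁻¹)·E·s)²·Σ_x J(x)²` (`supp ζ ⊂ B(y)`, `|ζ| ≤ s`, `supp J ⊂ B′(y′)`).
  Inputs BY NAME: FILE 4's `thm314_Gdiv_flat_V1_of_majorants`, `thm314_gradG_l2_flat_V1_of_majorants`, `thm314_Gdiv_l2_flat_V1_of_majorants` (with `A₃`,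
  `δ₃ = σ₁/4` from the pad twin at `α = ½`, `σ = σ₁`) and `B6Prop26DivKLevelPadV1.prop26_2136_div_kLevel_unconditional_pad_V1` for each of the two
  families.
* §3 **`thm314_G_all_flat_V1`** — there are `δ, C, M₀ > 0`, `N₀ > 0` (on `d, L` and the weight band `[b₀, b₁]` only; `k`-uniform, uniform in the
  direction `ν`, independent of the two families) such that for every V1 torus, every pair of p21 torus families `D, D′` on it (`1 ≤ k`, `M_h = L^a ≥ 8`,
  `R ≥ 2L²`, `P_μ ≥ 5L`, `L ≥ 5`, `L·M_h ≥ M₀`, `R·L·M_h ≥ N₀ + 1`), every fine factor `c_f ≠ 0`, positive weights `w, w′` in the global band agreeing on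
  the common index bonds, and common top blocks `y, y′`, with `E := e^{−δ·min(d(y,y′), d′(y,y′))}·e^{−δ·d(y,y′,Ω)}`:
  (SUP) for `supp μ ⊂ B′(y′)`, `|μ| ≤ B`, every fine bond `x ∈ B(y)` and every direction `ν`:
  `|((G[Ω] − G[Ω′])μ)(x)| ≤ C·(Lᵏ/c_f)²·B·E`, `|(∇_ν(G[Ω] − G[Ω′])μ)(x)| ≤ C·(Lᵏ|c_f|⁻¹)·B·E`, `|((G[Ω] − G[Ω′])∇*_νμ)(x)| ≤ C·(Lᵏ|c_f|⁻¹)·B·E`,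
  `|(Δ(G[Ω] − G[Ω′])μ)(x)| ≤ C·B·E` (the four members of (2.136) with the factor (3.154));
  (L²) for `supp ζ ⊂ B(y)`, `|ζ| ≤ s`, `supp J ⊂ B′(y′)` and every `ν`:
  `Σ_x (ζ(x)((G[Ω] − G[Ω′])J)(x))² ≤ (C·(Lᵏ/c_f)²·E·s)²·Σ_x J(x)²`, `Σ_x (ζ(x)(∇_ν(G[Ω] − G[Ω′])J)(x))², Σ_x (ζ(x)((G[Ω] − G[Ω′])∇*_νJ)(x))² ≤
  (C·(Lᵏ|c_f|⁻¹)·E·s)²·Σ_x J(x)²` (the first three members of (2.140) with the factor (3.154)).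
  Inputs BY NAME (constants merged by §2 `weaken_sup`/`weaken_l2`: `δ` = the minimum of the rates, `C, M₀, N₀` = the maxima): FILE 2's `thm314_G_flat_V1`,
  `thm314_gradG_flat_V1`, FILE 3's `thm314_lapG_flat_V1`, FILE 4's `thm314_G_l2_flat_V1`, and §1's three theorems.

## HONEST SCOPE

* §1: hypotheses of FILE 4 §4/§9 with the threshold `M₀` enlarged by the pad twin's `M₂`; rates `δ/4` of the common input rate.  §3: exactly the union
  of the seven inputs' hypotheses.  `U = 1`; `1 ≤ k`; common TOP blocks; `(Lᵏ/c_f)² = pref c_f y` and `Lᵏ = (geomT D).len y` on a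
  top block.  Not covered HERE: the Hölder members (2.137)₁,₂ (two-family forms modulo one-family inputs in `B9Thm314GFlatV1Holder`,
  `B9Thm314GFlatV1DivHolder`; (2.137)₁ knit in `B9Thm314HFlatV1Holder.thm314_gradG_holderPair_flat_V1`), (2.138)–(2.139) and the `L²` members
  (2.140)₄₋₆ (no two-family form in the tree); the other operators of Theorem 3.14 (`H` and `(QGQ*)⁻¹` in `B9Thm314HFlatV1*`, `B9Thm314QGQ*`; `𝔊`,
  `G₁`, `H₁` not).  ROUTE as FILES 1–5 (second resolvent identity).  Nothing is inferred from the manuscript.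
-/

noncomputable section

open scoped BigOperators Matrix
open Finset

namespace Literature.MathematicalPhysics.QuantumFieldTheory.Balaban1983to89.B9Thm314GFlatV1All

open B6MultiLevelBoxOperator (N0)
open B6MultiLevelTorusOperator (TDomains)
open B6Geom246MultiLevelBox (bset)
open B6Geom246MultiLevelTorus (geomT triangle_refl_nonneg_T)
open B6RandomWalk (BlockSupp)
open B6Ineq2133TwoScaleV1 (onFun)
open B6SectAOperatorsV1 (BondIdx)
open B6SectAVectorModelV1 (GE)
open B6GlobalChartV1 (PV blkV1 domT)
open B9Thm314GpFlatTorusGeometry (dOmega dOmega_nonneg)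
open B6CubeWindowV1 (GlobalBand)
open B6Prop26KLevelSkeletonV1 (pref pref_nonneg)
open B6LapLegKLevelV1 (DVa LapV)
open B6GradLegKLevelV1 (DV)
open B6Prop26DivKLevelPadV1 (prop26_2136_div_kLevel_unconditional_pad_V1)
open B9Thm314GFlatV1Transfer (thm314_G_flat_V1 thm314_gradG_flat_V1)
open B9Thm314GFlatV1MultiLevelTorus (thm314_lapG_flat_V1)
open B9Thm314GFlatV1DivTransfer (pref_of_top len_of_top thm314_Gdiv_flat_V1_of_majorants thm314_G_l2_flat_V1
  thm314_gradG_l2_flat_V1_of_majorants thm314_Gdiv_l2_flat_V1_of_majorants)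

variable {d : ℕ}

/-! ## §1  The (2.136)₃ member and the `L²` members (2.140)₂,₃, unconditional -/

/-- **THEOREM 3.14 AT `U = 1` — THE (2.136)₃ MEMBER (`G∇*`) WITH THE FACTOR (3.154) FOR THE GENUINE `k`-LEVEL `G = Δ_a⁻¹` OF TWO NESTED FAMILIES ON
THE V1 TORUS**: `|((G[Ω] − G[Ω′])∇*_ν μ)(x)| ≤ C·(L^k·|c_f|⁻¹)·B·e^{−δ·min(d(y,y′), d′(y,y′))}·e^{−δ·d(y,y′,Ω)}` for `x ∈ B(y)`, `supp μ ⊂ B(y′)`,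
`|μ| ≤ B`, `y, y′ ∈ Ω^{(k)}` common top blocks (FILE 4's member modulo the one-family majorants, discharged by the one-family (2.136)₃ pad twin of `B6Prop26DivKLevelPadV1`).
[cite: Balaban1985BackgroundPropagators, Thm 3.14 (3.153)–(3.154) pp.426–427; Balaban1984PropagatorsII, Prop. 2.6 (2.136) p.247, (2.19)–(2.22) p.226] -/
theorem thm314_Gdiv_flat_V1 (d ℓ : ℕ) (hd : 1 ≤ d + 1) (hL : Odd (ℓ + 1) ∧ 1 < ℓ + 1) {b₀ b₁ : ℝ} (hb₀ : 0 < b₀) (hb₁ : b₀ ≤ b₁) :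
    ∃ δ C M₀ : ℝ, ∃ N₀ : ℕ, 0 < δ ∧ 0 < C ∧ 0 < M₀ ∧ 0 < N₀ ∧
      ∀ (m K : ℕ) {Mh k R : ℕ} {P' : Fin (d + 1) → ℕ}
        (hN : ∀ μ, N0 ℓ Mh k P' μ = (PV d ℓ m K hd hL).sitesPerDir 0) (D D' : TDomains d ℓ Mh k P' R) (hk : k ≤ m + K),
        1 ≤ k → ∀ {a : ℕ}, Mh = (ℓ + 1) ^ a → 8 ≤ Mh → 2 * (ℓ + 1) ^ 2 ≤ R → (∀ μ, 5 * (ℓ + 1) ≤ P' μ) → 4 ≤ ℓ →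
        M₀ ≤ ((ℓ : ℝ) + 1) * Mh → N₀ + 1 ≤ R * ((ℓ + 1) * Mh) →
        ∀ {cf : ℝ} (hcf : cf ≠ 0) {w : BondIdx (domT hN D hk) → ℝ} (hw : ∀ i, 0 < w i)
          {w' : BondIdx (domT hN D' hk) → ℝ} (hw' : ∀ i', 0 < w' i'),
        GlobalBand b₀ b₁ cf w → GlobalBand b₀ b₁ cf w' →
        (∀ (i : BondIdx (domT hN D hk)) (i' : BondIdx (domT hN D' hk)), i.1 = i'.1 → w i = w' i') →
        ∀ (y : ↥(bset D.toDomains)) (hyD' : y.1 ∈ bset D'.toDomains) (y' : ↥(bset D'.toDomains)) (hy'D : y'.1 ∈ bset D.toDomains),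
        y.1.1 = k → y'.1.1 = k →
        ∀ (μ : PBond (PV d ℓ m K hd hL) 0 → ℝ) (B : ℝ), BlockSupp (g := geomT D') (blkV1 hN D') μ y' B →
        ∀ (ν : Fin (d + 1)) (x : PBond (PV d ℓ m K hd hL) 0), blkV1 hN D x = y →
          |(onFun (GE (domT hN D hk) hcf hw) * DVa ν cf : Module.End ℝ (PBond (PV d ℓ m K hd hL) 0 → ℝ)) μ x
              - (onFun (GE (domT hN D' hk) hcf hw') * DVa ν cf : Module.End ℝ (PBond (PV d ℓ m K hd hL) 0 → ℝ)) μ x|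
            ≤ C * ((geomT D).len y * |cf|⁻¹ * B)
              * Real.exp (-(δ * min ((geomT D).dist y ⟨y'.1, hy'D⟩) ((geomT D').dist ⟨y.1, hyD'⟩ y')))
              * Real.exp (-(δ * dOmega D D' y.1.2 y'.1.2)) := by
  -- the one-family (2.136)₃ pad twin at `σ = σ₁`, `α = ½` (rate `(1 − ½)σ₁/2`)
  obtain ⟨σ₁, hσ₁, h22⟩ := prop26_2136_div_kLevel_unconditional_pad_V1 d ℓ hd hL hb₀ hb₁
  obtain ⟨A₃, M₂, hA₃, hM₂, h3⟩ := h22 σ₁ hσ₁ le_rfl (1 / 2) (by norm_num) (by norm_num)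
  have hδ₃ : 0 < (1 - 1 / 2) * σ₁ / 2 := by
    have : (0 : ℝ) < 1 - 1 / 2 := by norm_num
    positivity
  -- FILE 4's member modulo the majorants
  obtain ⟨δ, C, M₀, N₀, hδ, hC, hM₀, hN₀, hmain⟩ := thm314_Gdiv_flat_V1_of_majorants d ℓ hd hL hb₀ hb₁ hA₃ hδ₃
  refine ⟨δ, C, max M₀ M₂, N₀, hδ, hC, lt_max_of_lt_left hM₀, hN₀, ?_⟩
  intro m K Mh k R P' hN D D' hk hk1 a hMha hM8 hR2 hP5 hℓ4 hM hRN cf hcf w hw w' hw' hwb hwb' hww y hyD' y' hy'D hy hy' μ B hμ ν x hx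
  have hM0 : M₀ ≤ ((ℓ : ℝ) + 1) * Mh := (le_max_left _ _).trans hM
  have hM2 : M₂ ≤ ((ℓ : ℝ) + 1) * Mh := (le_max_right _ _).trans hM
  have hT3 := h3 m K hN D hk hk1 hMha hM8 hR2 hP5 hℓ4 hM2 hcf hw hwb ν
  have hT3' := h3 m K hN D' hk hk1 hMha hM8 hR2 hP5 hℓ4 hM2 hcf hw' hwb' ν
  exact hmain m K hN D D' hk hk1 hMha hM8 hR2 hP5 hℓ4 hM0 hRN hcf hw hw' hwb hwb' hww ν hT3 hT3' y hyD' y' hy'D hy hy' μ B hμ x hx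

/-- **THEOREM 3.14 AT `U = 1` — THE `L²` MEMBER (2.140)₂ (`∇G`) WITH THE FACTOR (3.154) FOR THE GENUINE `k`-LEVEL `G = Δ_a⁻¹`, UNCONDITIONAL**:
`Σ_x (ζ(x)(∇_ν(G[Ω] − G[Ω′])J)(x))² ≤ (C·(L^k|c_f|⁻¹)·e^{−δ·min(d(y,y′),d′(y,y′))}·e^{−δ·d(y,y′,Ω)}·s)²·Σ_x J(x)²` for `supp ζ ⊂ B(y)`, `|ζ| ≤ s`, `supp J ⊂ B′(y′)`,
`y, y′ ∈ Ω^{(k)}` common top blocks.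
[cite: Balaban1985BackgroundPropagators, Thm 3.14 (3.153)–(3.154) pp.426–427; Balaban1984PropagatorsII, Prop. 2.6 (2.140) p.247, (2.136) p.247] -/
theorem thm314_gradG_l2_flat_V1 (d ℓ : ℕ) (hd : 1 ≤ d + 1) (hL : Odd (ℓ + 1) ∧ 1 < ℓ + 1) {b₀ b₁ : ℝ} (hb₀ : 0 < b₀) (hb₁ : b₀ ≤ b₁) :
    ∃ δ C M₀ : ℝ, ∃ N₀ : ℕ, 0 < δ ∧ 0 < C ∧ 0 < M₀ ∧ 0 < N₀ ∧
      ∀ (m K : ℕ) {Mh k R : ℕ} {P' : Fin (d + 1) → ℕ}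
        (hN : ∀ μ, N0 ℓ Mh k P' μ = (PV d ℓ m K hd hL).sitesPerDir 0) (D D' : TDomains d ℓ Mh k P' R) (hk : k ≤ m + K),
        1 ≤ k → ∀ {a : ℕ}, Mh = (ℓ + 1) ^ a → 8 ≤ Mh → 2 * (ℓ + 1) ^ 2 ≤ R → (∀ μ, 5 * (ℓ + 1) ≤ P' μ) → 4 ≤ ℓ →
        M₀ ≤ ((ℓ : ℝ) + 1) * Mh → N₀ + 1 ≤ R * ((ℓ + 1) * Mh) →
        ∀ {cf : ℝ} (hcf : cf ≠ 0) {w : BondIdx (domT hN D hk) → ℝ} (hw : ∀ i, 0 < w i)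
          {w' : BondIdx (domT hN D' hk) → ℝ} (hw' : ∀ i', 0 < w' i'),
        GlobalBand b₀ b₁ cf w → GlobalBand b₀ b₁ cf w' →
        (∀ (i : BondIdx (domT hN D hk)) (i' : BondIdx (domT hN D' hk)), i.1 = i'.1 → w i = w' i') →
        ∀ (y : ↥(bset D.toDomains)) (hyD' : y.1 ∈ bset D'.toDomains) (y' : ↥(bset D'.toDomains)) (hy'D : y'.1 ∈ bset D.toDomains),
        y.1.1 = k → y'.1.1 = k →
        ∀ (ν : Fin (d + 1)) (ζ J : PBond (PV d ℓ m K hd hL) 0 → ℝ) (s : ℝ), (∀ x, blkV1 hN D x ≠ y → ζ x = 0) → (∀ x, |ζ x| ≤ s) →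
        (∀ x, blkV1 hN D' x ≠ y' → J x = 0) →
          ∑ x, (ζ x * ((DV ν cf ∘ₗ onFun (GE (domT hN D hk) hcf hw)) J x - (DV ν cf ∘ₗ onFun (GE (domT hN D' hk) hcf hw')) J x)) ^ 2
            ≤ (C * (((ℓ : ℝ) + 1) ^ k * |cf|⁻¹)
                * Real.exp (-(δ * min ((geomT D).dist y ⟨y'.1, hy'D⟩) ((geomT D').dist ⟨y.1, hyD'⟩ y')))
                * Real.exp (-(δ * dOmega D D' y.1.2 y'.1.2)) * s) ^ 2 * ∑ x, J x ^ 2 := by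
  obtain ⟨σ₁, hσ₁, h22⟩ := prop26_2136_div_kLevel_unconditional_pad_V1 d ℓ hd hL hb₀ hb₁
  obtain ⟨A₃, M₂, hA₃, hM₂, h3⟩ := h22 σ₁ hσ₁ le_rfl (1 / 2) (by norm_num) (by norm_num)
  have hδ₃ : 0 < (1 - 1 / 2) * σ₁ / 2 := by
    have : (0 : ℝ) < 1 - 1 / 2 := by norm_num
    positivity
  obtain ⟨δ, C, M₀, N₀, hδ, hC, hM₀, hN₀, hmain⟩ := thm314_gradG_l2_flat_V1_of_majorants d ℓ hd hL hb₀ hb₁ hA₃ hδ₃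
  refine ⟨δ, C, max M₀ M₂, N₀, hδ, hC, lt_max_of_lt_left hM₀, hN₀, ?_⟩
  intro m K Mh k R P' hN D D' hk hk1 a hMha hM8 hR2 hP5 hℓ4 hM hRN cf hcf w hw w' hw' hwb hwb' hww y hyD' y' hy'D hy hy' ν ζ J s hζ hζs hJ
  have hM0 : M₀ ≤ ((ℓ : ℝ) + 1) * Mh := (le_max_left _ _).trans hM
  have hM2 : M₂ ≤ ((ℓ : ℝ) + 1) * Mh := (le_max_right _ _).trans hM
  have hT3 := h3 m K hN D hk hk1 hMha hM8 hR2 hP5 hℓ4 hM2 hcf hw hwb ν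
  have hT3' := h3 m K hN D' hk hk1 hMha hM8 hR2 hP5 hℓ4 hM2 hcf hw' hwb' ν
  exact hmain m K hN D D' hk hk1 hMha hM8 hR2 hP5 hℓ4 hM0 hRN hcf hw hw' hwb hwb' hww ν hT3 hT3' y hyD' y' hy'D hy hy' ζ J s hζ hζs hJ

/-- **THEOREM 3.14 AT `U = 1` — THE `L²` MEMBER (2.140)₃ (`G∇*`) WITH THE FACTOR (3.154) FOR THE GENUINE `k`-LEVEL `G = Δ_a⁻¹`, UNCONDITIONAL**:
`Σ_x (ζ(x)((G[Ω] − G[Ω′])∇*_νJ)(x))² ≤ (C·(L^k|c_f|⁻¹)·e^{−δ·min(d(y,y′),d′(y,y′))}·e^{−δ·d(y,y′,Ω)}·s)²·Σ_x J(x)²` for `supp ζ ⊂ B(y)`, `|ζ| ≤ s`, `supp J ⊂ B′(y′)`,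
`y, y′ ∈ Ω^{(k)}` common top blocks.
[cite: Balaban1985BackgroundPropagators, Thm 3.14 (3.153)–(3.154) pp.426–427; Balaban1984PropagatorsII, Prop. 2.6 (2.140) p.247, (2.136) p.247] -/
theorem thm314_Gdiv_l2_flat_V1 (d ℓ : ℕ) (hd : 1 ≤ d + 1) (hL : Odd (ℓ + 1) ∧ 1 < ℓ + 1) {b₀ b₁ : ℝ} (hb₀ : 0 < b₀) (hb₁ : b₀ ≤ b₁) :
    ∃ δ C M₀ : ℝ, ∃ N₀ : ℕ, 0 < δ ∧ 0 < C ∧ 0 < M₀ ∧ 0 < N₀ ∧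
      ∀ (m K : ℕ) {Mh k R : ℕ} {P' : Fin (d + 1) → ℕ}
        (hN : ∀ μ, N0 ℓ Mh k P' μ = (PV d ℓ m K hd hL).sitesPerDir 0) (D D' : TDomains d ℓ Mh k P' R) (hk : k ≤ m + K),
        1 ≤ k → ∀ {a : ℕ}, Mh = (ℓ + 1) ^ a → 8 ≤ Mh → 2 * (ℓ + 1) ^ 2 ≤ R → (∀ μ, 5 * (ℓ + 1) ≤ P' μ) → 4 ≤ ℓ →
        M₀ ≤ ((ℓ : ℝ) + 1) * Mh → N₀ + 1 ≤ R * ((ℓ + 1) * Mh) →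
        ∀ {cf : ℝ} (hcf : cf ≠ 0) {w : BondIdx (domT hN D hk) → ℝ} (hw : ∀ i, 0 < w i)
          {w' : BondIdx (domT hN D' hk) → ℝ} (hw' : ∀ i', 0 < w' i'),
        GlobalBand b₀ b₁ cf w → GlobalBand b₀ b₁ cf w' →
        (∀ (i : BondIdx (domT hN D hk)) (i' : BondIdx (domT hN D' hk)), i.1 = i'.1 → w i = w' i') →
        ∀ (y : ↥(bset D.toDomains)) (hyD' : y.1 ∈ bset D'.toDomains) (y' : ↥(bset D'.toDomains)) (hy'D : y'.1 ∈ bset D.toDomains),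
        y.1.1 = k → y'.1.1 = k →
        ∀ (ν : Fin (d + 1)) (ζ J : PBond (PV d ℓ m K hd hL) 0 → ℝ) (s : ℝ), (∀ x, blkV1 hN D x ≠ y → ζ x = 0) → (∀ x, |ζ x| ≤ s) →
        (∀ x, blkV1 hN D' x ≠ y' → J x = 0) →
          ∑ x, (ζ x * ((onFun (GE (domT hN D hk) hcf hw) * DVa ν cf : Module.End ℝ (PBond (PV d ℓ m K hd hL) 0 → ℝ)) J x
              - (onFun (GE (domT hN D' hk) hcf hw') * DVa ν cf : Module.End ℝ (PBond (PV d ℓ m K hd hL) 0 → ℝ)) J x)) ^ 2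
            ≤ (C * (((ℓ : ℝ) + 1) ^ k * |cf|⁻¹)
                * Real.exp (-(δ * min ((geomT D).dist y ⟨y'.1, hy'D⟩) ((geomT D').dist ⟨y.1, hyD'⟩ y')))
                * Real.exp (-(δ * dOmega D D' y.1.2 y'.1.2)) * s) ^ 2 * ∑ x, J x ^ 2 := by
  obtain ⟨σ₁, hσ₁, h22⟩ := prop26_2136_div_kLevel_unconditional_pad_V1 d ℓ hd hL hb₀ hb₁
  obtain ⟨A₃, M₂, hA₃, hM₂, h3⟩ := h22 σ₁ hσ₁ le_rfl (1 / 2) (by norm_num) (by norm_num)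
  have hδ₃ : 0 < (1 - 1 / 2) * σ₁ / 2 := by
    have : (0 : ℝ) < 1 - 1 / 2 := by norm_num
    positivity
  obtain ⟨δ, C, M₀, N₀, hδ, hC, hM₀, hN₀, hmain⟩ := thm314_Gdiv_l2_flat_V1_of_majorants d ℓ hd hL hb₀ hb₁ hA₃ hδ₃
  refine ⟨δ, C, max M₀ M₂, N₀, hδ, hC, lt_max_of_lt_left hM₀, hN₀, ?_⟩
  intro m K Mh k R P' hN D D' hk hk1 a hMha hM8 hR2 hP5 hℓ4 hM hRN cf hcf w hw w' hw' hwb hwb' hww y hyD' y' hy'D hy hy' ν ζ J s hζ hζs hJ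
  have hM0 : M₀ ≤ ((ℓ : ℝ) + 1) * Mh := (le_max_left _ _).trans hM
  have hM2 : M₂ ≤ ((ℓ : ℝ) + 1) * Mh := (le_max_right _ _).trans hM
  have hT3 := h3 m K hN D hk hk1 hMha hM8 hR2 hP5 hℓ4 hM2 hcf hw hwb ν
  have hT3' := h3 m K hN D' hk hk1 hMha hM8 hR2 hP5 hℓ4 hM2 hcf hw' hwb' ν
  exact hmain m K hN D D' hk hk1 hMha hM8 hR2 hP5 hℓ4 hM0 hRN hcf hw hw' hwb hwb' hww ν hT3 hT3' y hyD' y' hy'D hy hy' ζ J s hζ hζs hJ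

/-! ## §2  Merging constants -/

/-- weakening a sup bound `X ≤ Cᵢ·W·e^{−δᵢm}·e^{−δᵢd_Ω}` to a smaller rate and a larger constant. [folklore] -/
private theorem weaken_sup {X Ci C W δi δ m dΩ : ℝ} (hδ : δ ≤ δi) (hCi : 0 ≤ Ci) (hC : Ci ≤ C) (hW : 0 ≤ W) (hm : 0 ≤ m) (hΩ : 0 ≤ dΩ)
    (h : X ≤ Ci * W * Real.exp (-(δi * m)) * Real.exp (-(δi * dΩ))) :
    X ≤ C * W * Real.exp (-(δ * m)) * Real.exp (-(δ * dΩ)) := by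
  have h1 : Real.exp (-(δi * m)) ≤ Real.exp (-(δ * m)) := Real.exp_le_exp.2 (by nlinarith)
  have h2 : Real.exp (-(δi * dΩ)) ≤ Real.exp (-(δ * dΩ)) := Real.exp_le_exp.2 (by nlinarith)
  refine h.trans ?_
  have h12 := mul_le_mul h1 h2 (Real.exp_pos _).le (Real.exp_pos _).le
  calc Ci * W * Real.exp (-(δi * m)) * Real.exp (-(δi * dΩ))
      = Ci * W * (Real.exp (-(δi * m)) * Real.exp (-(δi * dΩ))) := by ring
    _ ≤ C * W * (Real.exp (-(δ * m)) * Real.exp (-(δ * dΩ))) :=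
        mul_le_mul (mul_le_mul_of_nonneg_right hC hW) h12 (by positivity) (mul_nonneg (hCi.trans hC) hW)
    _ = _ := by ring

/-- weakening an `L²` bound `X ≤ (Cᵢ·W·e^{−δᵢm}·e^{−δᵢd_Ω}·s)²·S` (`S ≥ 0`) to a smaller rate and a larger constant. [folklore] -/
private theorem weaken_l2 {X Ci C W δi δ m dΩ s S : ℝ} (hδ : δ ≤ δi) (hCi : 0 ≤ Ci) (hC : Ci ≤ C) (hW : 0 ≤ W) (hm : 0 ≤ m) (hΩ : 0 ≤ dΩ)
    (hS : 0 ≤ S) (h : X ≤ (Ci * W * Real.exp (-(δi * m)) * Real.exp (-(δi * dΩ)) * s) ^ 2 * S) :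
    X ≤ (C * W * Real.exp (-(δ * m)) * Real.exp (-(δ * dΩ)) * s) ^ 2 * S := by
  have hle : Ci * W * Real.exp (-(δi * m)) * Real.exp (-(δi * dΩ)) ≤ C * W * Real.exp (-(δ * m)) * Real.exp (-(δ * dΩ)) :=
    weaken_sup hδ hCi hC hW hm hΩ le_rfl
  have h0 : 0 ≤ Ci * W * Real.exp (-(δi * m)) * Real.exp (-(δi * dΩ)) := by positivity
  refine h.trans (mul_le_mul_of_nonneg_right ?_ hS)
  rw [mul_pow, mul_pow (C * W * _ * _)]
  exact mul_le_mul_of_nonneg_right (pow_le_pow_left₀ h0 hle 2) (sq_nonneg s)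

/-! ## §3  Theorem 3.14 at `U = 1` for `G = Δ_a⁻¹`: all members with one set of constants -/

open Classical in
/-- **THEOREM 3.14 AT `U = 1` FOR THE GENUINE `k`-LEVEL `G = Δ_a⁻¹` OF TWO NESTED FAMILIES ON THE V1 TORUS — THE SUP MEMBERS (2.136)₁₋₄ AND THE `L²`
MEMBERS (2.140)₁₋₃ WITH ONE SET OF CONSTANTS**: «their difference satisfies all the inequalities characteristic for operators of the considered type,
with the additional factor exp(−δ₀d(y,y′,Ω))» — here, for common top blocks `y, y′` and `E = e^{−δ·min(d(y,y′),d′(y,y′))}·e^{−δ·d(y,y′,Ω)}`: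
`|((G[Ω] − G[Ω′])μ)(x)| ≤ C(Lᵏ/c_f)²BE`, `|(∇_ν(…)μ)(x)|, |((…)∇*_νμ)(x)| ≤ C(Lᵏ|c_f|⁻¹)BE`, `|(Δ(…)μ)(x)| ≤ CBE` (`x ∈ B(y)`, `supp μ ⊂ B′(y′)`,
`|μ| ≤ B`), and `‖ζ(…)J‖ ≤ C(Lᵏ/c_f)²E s‖J‖`, `‖ζ∇_ν(…)J‖, ‖ζ(…)∇*_νJ‖ ≤ C(Lᵏ|c_f|⁻¹)E s‖J‖` (squared form; `supp ζ ⊂ B(y)`, `|ζ| ≤ s`,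
`supp J ⊂ B′(y′)`).
[cite: Balaban1985BackgroundPropagators, Thm 3.14 (3.153)–(3.154) pp.426–427; Balaban1984PropagatorsII, Prop. 2.6 (2.136), (2.140) p.247] -/
theorem thm314_G_all_flat_V1 (d ℓ : ℕ) (hd : 1 ≤ d + 1) (hL : Odd (ℓ + 1) ∧ 1 < ℓ + 1) {b₀ b₁ : ℝ} (hb₀ : 0 < b₀) (hb₁ : b₀ ≤ b₁) :
    ∃ δ C M₀ : ℝ, ∃ N₀ : ℕ, 0 < δ ∧ 0 < C ∧ 0 < M₀ ∧ 0 < N₀ ∧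
      ∀ (m K : ℕ) {Mh k R : ℕ} {P' : Fin (d + 1) → ℕ}
        (hN : ∀ μ, N0 ℓ Mh k P' μ = (PV d ℓ m K hd hL).sitesPerDir 0) (D D' : TDomains d ℓ Mh k P' R) (hk : k ≤ m + K),
        1 ≤ k → ∀ {a : ℕ}, Mh = (ℓ + 1) ^ a → 8 ≤ Mh → 2 * (ℓ + 1) ^ 2 ≤ R → (∀ μ, 5 * (ℓ + 1) ≤ P' μ) → 4 ≤ ℓ →
        M₀ ≤ ((ℓ : ℝ) + 1) * Mh → N₀ + 1 ≤ R * ((ℓ + 1) * Mh) →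
        ∀ {cf : ℝ} (hcf : cf ≠ 0) {w : BondIdx (domT hN D hk) → ℝ} (hw : ∀ i, 0 < w i)
          {w' : BondIdx (domT hN D' hk) → ℝ} (hw' : ∀ i', 0 < w' i'),
        GlobalBand b₀ b₁ cf w → GlobalBand b₀ b₁ cf w' →
        (∀ (i : BondIdx (domT hN D hk)) (i' : BondIdx (domT hN D' hk)), i.1 = i'.1 → w i = w' i') →
        ∀ (y : ↥(bset D.toDomains)) (hyD' : y.1 ∈ bset D'.toDomains) (y' : ↥(bset D'.toDomains)) (hy'D : y'.1 ∈ bset D.toDomains),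
        y.1.1 = k → y'.1.1 = k →
        (∀ (μ : PBond (PV d ℓ m K hd hL) 0 → ℝ) (B : ℝ), BlockSupp (g := geomT D') (blkV1 hN D') μ y' B →
          ∀ x : PBond (PV d ℓ m K hd hL) 0, blkV1 hN D x = y →
            |onFun (GE (domT hN D hk) hcf hw) μ x - onFun (GE (domT hN D' hk) hcf hw') μ x|
                ≤ C * (((((ℓ + 1 : ℕ) : ℝ)) ^ k / cf) ^ 2 * B)
                  * Real.exp (-(δ * min ((geomT D).dist y ⟨y'.1, hy'D⟩) ((geomT D').dist ⟨y.1, hyD'⟩ y')))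
                  * Real.exp (-(δ * dOmega D D' y.1.2 y'.1.2)) ∧
            (∀ ν : Fin (d + 1),
              |(DV ν cf ∘ₗ onFun (GE (domT hN D hk) hcf hw)) μ x - (DV ν cf ∘ₗ onFun (GE (domT hN D' hk) hcf hw')) μ x|
                ≤ C * ((((ℓ : ℝ) + 1)) ^ k * |cf|⁻¹ * B)
                  * Real.exp (-(δ * min ((geomT D).dist y ⟨y'.1, hy'D⟩) ((geomT D').dist ⟨y.1, hyD'⟩ y')))
                  * Real.exp (-(δ * dOmega D D' y.1.2 y'.1.2))) ∧
            (∀ ν : Fin (d + 1),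
              |(onFun (GE (domT hN D hk) hcf hw) * DVa ν cf : Module.End ℝ (PBond (PV d ℓ m K hd hL) 0 → ℝ)) μ x
                  - (onFun (GE (domT hN D' hk) hcf hw') * DVa ν cf : Module.End ℝ (PBond (PV d ℓ m K hd hL) 0 → ℝ)) μ x|
                ≤ C * ((((ℓ : ℝ) + 1)) ^ k * |cf|⁻¹ * B)
                  * Real.exp (-(δ * min ((geomT D).dist y ⟨y'.1, hy'D⟩) ((geomT D').dist ⟨y.1, hyD'⟩ y')))
                  * Real.exp (-(δ * dOmega D D' y.1.2 y'.1.2))) ∧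
            |(LapV cf ∘ₗ onFun (GE (domT hN D hk) hcf hw)) μ x - (LapV cf ∘ₗ onFun (GE (domT hN D' hk) hcf hw')) μ x|
                ≤ C * B
                  * Real.exp (-(δ * min ((geomT D).dist y ⟨y'.1, hy'D⟩) ((geomT D').dist ⟨y.1, hyD'⟩ y')))
                  * Real.exp (-(δ * dOmega D D' y.1.2 y'.1.2))) ∧
        (∀ (ζ J : PBond (PV d ℓ m K hd hL) 0 → ℝ) (s : ℝ), (∀ x, blkV1 hN D x ≠ y → ζ x = 0) → (∀ x, |ζ x| ≤ s) →
          (∀ x, blkV1 hN D' x ≠ y' → J x = 0) →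
            ∑ x, (ζ x * (onFun (GE (domT hN D hk) hcf hw) J x - onFun (GE (domT hN D' hk) hcf hw') J x)) ^ 2
                ≤ (C * ((((ℓ + 1 : ℕ) : ℝ)) ^ k / cf) ^ 2
                    * Real.exp (-(δ * min ((geomT D).dist y ⟨y'.1, hy'D⟩) ((geomT D').dist ⟨y.1, hyD'⟩ y')))
                    * Real.exp (-(δ * dOmega D D' y.1.2 y'.1.2)) * s) ^ 2 * ∑ x, J x ^ 2 ∧
            (∀ ν : Fin (d + 1),
              ∑ x, (ζ x * ((DV ν cf ∘ₗ onFun (GE (domT hN D hk) hcf hw)) J x - (DV ν cf ∘ₗ onFun (GE (domT hN D' hk) hcf hw')) J x)) ^ 2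
                ≤ (C * ((((ℓ : ℝ) + 1)) ^ k * |cf|⁻¹)
                    * Real.exp (-(δ * min ((geomT D).dist y ⟨y'.1, hy'D⟩) ((geomT D').dist ⟨y.1, hyD'⟩ y')))
                    * Real.exp (-(δ * dOmega D D' y.1.2 y'.1.2)) * s) ^ 2 * ∑ x, J x ^ 2) ∧
            (∀ ν : Fin (d + 1),
              ∑ x, (ζ x * ((onFun (GE (domT hN D hk) hcf hw) * DVa ν cf : Module.End ℝ (PBond (PV d ℓ m K hd hL) 0 → ℝ)) J x
                  - (onFun (GE (domT hN D' hk) hcf hw') * DVa ν cf : Module.End ℝ (PBond (PV d ℓ m K hd hL) 0 → ℝ)) J x)) ^ 2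
                ≤ (C * ((((ℓ : ℝ) + 1)) ^ k * |cf|⁻¹)
                    * Real.exp (-(δ * min ((geomT D).dist y ⟨y'.1, hy'D⟩) ((geomT D').dist ⟨y.1, hyD'⟩ y')))
                    * Real.exp (-(δ * dOmega D D' y.1.2 y'.1.2)) * s) ^ 2 * ∑ x, J x ^ 2)) := by
  obtain ⟨δ₁, C₁, M₁, N₁, hδ₁, hC₁, hM₁, hN₁, h1⟩ := thm314_G_flat_V1 d ℓ hd hL hb₀ hb₁
  obtain ⟨δ₂, C₂, M₂, N₂, hδ₂, hC₂, hM₂, hN₂, h2⟩ := thm314_gradG_flat_V1 d ℓ hd hL hb₀ hb₁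
  obtain ⟨δ₃, C₃, M₃, N₃, hδ₃, hC₃, hM₃, hN₃, h3⟩ := thm314_Gdiv_flat_V1 d ℓ hd hL hb₀ hb₁
  obtain ⟨δ₄, C₄, M₄, N₄, hδ₄, hC₄, hM₄, hN₄, h4⟩ := thm314_lapG_flat_V1 d ℓ hd hL hb₀ hb₁
  obtain ⟨δ₅, C₅, M₅, N₅, hδ₅, hC₅, hM₅, hN₅, h5⟩ := thm314_G_l2_flat_V1 d ℓ hd hL hb₀ hb₁
  obtain ⟨δ₆, C₆, M₆, N₆, hδ₆, hC₆, hM₆, hN₆, h6⟩ := thm314_gradG_l2_flat_V1 d ℓ hd hL hb₀ hb₁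
  obtain ⟨δ₇, C₇, M₇, N₇, hδ₇, hC₇, hM₇, hN₇, h7⟩ := thm314_Gdiv_l2_flat_V1 d ℓ hd hL hb₀ hb₁
  -- the merged constants
  set δ := min (min (min δ₁ δ₂) (min δ₃ δ₄)) (min (min δ₅ δ₆) δ₇) with hδdef
  set C := max (max (max C₁ C₂) (max C₃ C₄)) (max (max C₅ C₆) C₇) with hCdef
  set M₀ := max (max (max M₁ M₂) (max M₃ M₄)) (max (max M₅ M₆) M₇) with hM₀def
  set N₀ := max (max (max N₁ N₂) (max N₃ N₄)) (max (max N₅ N₆) N₇) with hN₀def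
  have hδle₁ : δ ≤ δ₁ := (min_le_left _ _).trans ((min_le_left _ _).trans (min_le_left _ _))
  have hδle₂ : δ ≤ δ₂ := (min_le_left _ _).trans ((min_le_left _ _).trans (min_le_right _ _))
  have hδle₃ : δ ≤ δ₃ := (min_le_left _ _).trans ((min_le_right _ _).trans (min_le_left _ _))
  have hδle₄ : δ ≤ δ₄ := (min_le_left _ _).trans ((min_le_right _ _).trans (min_le_right _ _))
  have hδle₅ : δ ≤ δ₅ := (min_le_right _ _).trans ((min_le_left _ _).trans (min_le_left _ _))
  have hδle₆ : δ ≤ δ₆ := (min_le_right _ _).trans ((min_le_left _ _).trans (min_le_right _ _))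
  have hδle₇ : δ ≤ δ₇ := (min_le_right _ _).trans (min_le_right _ _)
  have hCle₁ : C₁ ≤ C := ((le_max_left _ _).trans (le_max_left _ _)).trans (le_max_left _ _)
  have hCle₂ : C₂ ≤ C := ((le_max_right _ _).trans (le_max_left _ _)).trans (le_max_left _ _)
  have hCle₃ : C₃ ≤ C := ((le_max_left _ _).trans (le_max_right _ _)).trans (le_max_left _ _)
  have hCle₄ : C₄ ≤ C := ((le_max_right _ _).trans (le_max_right _ _)).trans (le_max_left _ _)
  have hCle₅ : C₅ ≤ C := ((le_max_left _ _).trans (le_max_left _ _)).trans (le_max_right _ _)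
  have hCle₆ : C₆ ≤ C := ((le_max_right _ _).trans (le_max_left _ _)).trans (le_max_right _ _)
  have hCle₇ : C₇ ≤ C := (le_max_right _ _).trans (le_max_right _ _)
  have hMle₁ : M₁ ≤ M₀ := ((le_max_left _ _).trans (le_max_left _ _)).trans (le_max_left _ _)
  have hMle₂ : M₂ ≤ M₀ := ((le_max_right _ _).trans (le_max_left _ _)).trans (le_max_left _ _)
  have hMle₃ : M₃ ≤ M₀ := ((le_max_left _ _).trans (le_max_right _ _)).trans (le_max_left _ _)
  have hMle₄ : M₄ ≤ M₀ := ((le_max_right _ _).trans (le_max_right _ _)).trans (le_max_left _ _)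
  have hMle₅ : M₅ ≤ M₀ := ((le_max_left _ _).trans (le_max_left _ _)).trans (le_max_right _ _)
  have hMle₆ : M₆ ≤ M₀ := ((le_max_right _ _).trans (le_max_left _ _)).trans (le_max_right _ _)
  have hMle₇ : M₇ ≤ M₀ := (le_max_right _ _).trans (le_max_right _ _)
  have hNle₁ : N₁ ≤ N₀ := ((le_max_left _ _).trans (le_max_left _ _)).trans (le_max_left _ _)
  have hNle₂ : N₂ ≤ N₀ := ((le_max_right _ _).trans (le_max_left _ _)).trans (le_max_left _ _)
  have hNle₃ : N₃ ≤ N₀ := ((le_max_left _ _).trans (le_max_right _ _)).trans (le_max_left _ _)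
  have hNle₄ : N₄ ≤ N₀ := ((le_max_right _ _).trans (le_max_right _ _)).trans (le_max_left _ _)
  have hNle₅ : N₅ ≤ N₀ := ((le_max_left _ _).trans (le_max_left _ _)).trans (le_max_right _ _)
  have hNle₆ : N₆ ≤ N₀ := ((le_max_right _ _).trans (le_max_left _ _)).trans (le_max_right _ _)
  have hNle₇ : N₇ ≤ N₀ := (le_max_right _ _).trans (le_max_right _ _)
  have hδ0 : 0 < δ := lt_min (lt_min (lt_min hδ₁ hδ₂) (lt_min hδ₃ hδ₄)) (lt_min (lt_min hδ₅ hδ₆) hδ₇)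
  refine ⟨δ, C, M₀, N₀, hδ0, hC₁.trans_le hCle₁, hM₁.trans_le hMle₁, hN₁.trans_le hNle₁, ?_⟩
  intro m K Mh k R P' hN D D' hk hk1 a hMa hM8 hR2 hP5 hℓ4 hM₀ hN₀ cf hcf w hw w' hw' hGB hGB' hww' y hyD' y' hy'D hyk hy'k
  -- the thresholds of every input
  have hMi : ∀ {Mi : ℝ}, Mi ≤ M₀ → Mi ≤ ((ℓ : ℝ) + 1) * Mh := fun h => h.trans hM₀
  have hNi : ∀ {Ni : ℕ}, Ni ≤ N₀ → Ni + 1 ≤ R * ((ℓ + 1) * Mh) := fun h => le_trans (by omega) hN₀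
  -- non-negativity of the distances
  have hMh1 : 1 ≤ Mh := by omega
  have hP1 : ∀ μ, 1 ≤ P' μ := fun μ => le_trans (by omega) (hP5 μ)
  have hm0 : 0 ≤ min ((geomT D).dist y ⟨y'.1, hy'D⟩) ((geomT D').dist ⟨y.1, hyD'⟩ y') :=
    le_min ((triangle_refl_nonneg_T D hMh1 hP1).2.2 _ _) ((triangle_refl_nonneg_T D' hMh1 hP1).2.2 _ _)
  have hΩ0 : 0 ≤ dOmega D D' y.1.2 y'.1.2 := dOmega_nonneg D D' _ _
  -- the two top-block prefactors
  have hpref : pref cf y = ((((ℓ + 1 : ℕ) : ℝ)) ^ k / cf) ^ 2 := pref_of_top D cf hyk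
  have hlen : (geomT D).len y = (((ℓ : ℝ) + 1)) ^ k := len_of_top D hyk
  have hpref0 : 0 ≤ ((((ℓ + 1 : ℕ) : ℝ)) ^ k / cf) ^ 2 := sq_nonneg _
  have hlin0 : 0 ≤ (((ℓ : ℝ) + 1)) ^ k * |cf|⁻¹ :=
    mul_nonneg (pow_nonneg (Nat.cast_add_one_pos ℓ).le k) (inv_nonneg.mpr (abs_nonneg cf))
  refine ⟨fun μ B hμ x hx => ⟨?_, fun ν => ?_, fun ν => ?_, ?_⟩, fun ζ J s hζ hs hJ => ⟨?_, fun ν => ?_, fun ν => ?_⟩⟩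
  · have h := h1 m K hN D D' hk hk1 hMa hM8 hR2 hP5 hℓ4 (hMi hMle₁) (hNi hNle₁) hcf hw hw' hGB hGB' hww' y hyD' y' hy'D hyk hy'k μ B hμ x hx
    rw [hpref] at h
    exact weaken_sup hδle₁ hC₁.le hCle₁ (mul_nonneg hpref0 hμ.nonneg) hm0 hΩ0 h
  · have h := h2 m K hN D D' hk hk1 hMa hM8 hR2 hP5 hℓ4 (hMi hMle₂) (hNi hNle₂) hcf hw hw' hGB hGB' hww' y hyD' y' hy'D hyk hy'k μ B hμ ν x hx
    rw [hlen] at h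
    exact weaken_sup hδle₂ hC₂.le hCle₂ (mul_nonneg hlin0 hμ.nonneg) hm0 hΩ0 h
  · have h := h3 m K hN D D' hk hk1 hMa hM8 hR2 hP5 hℓ4 (hMi hMle₃) (hNi hNle₃) hcf hw hw' hGB hGB' hww' y hyD' y' hy'D hyk hy'k μ B hμ ν x hx
    rw [hlen] at h
    exact weaken_sup hδle₃ hC₃.le hCle₃ (mul_nonneg hlin0 hμ.nonneg) hm0 hΩ0 h
  · have h := h4 m K hN D D' hk hk1 hMa hM8 hR2 hP5 hℓ4 (hMi hMle₄) (hNi hNle₄) hcf hw hw' hGB hGB' hww' y hyD' y' hy'D hyk hy'k μ B hμ x hx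
    have h' : |(LapV cf ∘ₗ onFun (GE (domT hN D hk) hcf hw)) μ x - (LapV cf ∘ₗ onFun (GE (domT hN D' hk) hcf hw')) μ x|
        ≤ C₄ * B * Real.exp (-(δ₄ * min ((geomT D).dist y ⟨y'.1, hy'D⟩) ((geomT D').dist ⟨y.1, hyD'⟩ y')))
          * Real.exp (-(δ₄ * dOmega D D' y.1.2 y'.1.2)) := h
    exact weaken_sup hδle₄ hC₄.le hCle₄ hμ.nonneg hm0 hΩ0 h'
  · have h := h5 m K hN D D' hk hk1 hMa hM8 hR2 hP5 hℓ4 (hMi hMle₅) (hNi hNle₅) hcf hw hw' hGB hGB' hww' y hyD' y' hy'D hyk hy'k ζ J s hζ hs hJ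
    rw [hpref] at h
    exact weaken_l2 hδle₅ hC₅.le hCle₅ hpref0 hm0 hΩ0 (sum_nonneg fun x _ => sq_nonneg (J x)) h
  · have h := h6 m K hN D D' hk hk1 hMa hM8 hR2 hP5 hℓ4 (hMi hMle₆) (hNi hNle₆) hcf hw hw' hGB hGB' hww' y hyD' y' hy'D hyk hy'k ν ζ J s hζ hs hJ
    exact weaken_l2 hδle₆ hC₆.le hCle₆ hlin0 hm0 hΩ0 (sum_nonneg fun x _ => sq_nonneg (J x)) h
  · have h := h7 m K hN D D' hk hk1 hMa hM8 hR2 hP5 hℓ4 (hMi hMle₇) (hNi hNle₇) hcf hw hw' hGB hGB' hww' y hyD' y' hy'D hyk hy'k ν ζ J s hζ hs hJ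
    exact weaken_l2 hδle₇ hC₇.le hCle₇ hlin0 hm0 hΩ0 (sum_nonneg fun x _ => sq_nonneg (J x)) h

end Literature.MathematicalPhysics.QuantumFieldTheory.Balaban1983to89.B9Thm314GFlatV1All

end
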